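import Literature.NumberTheory.GaloisRepresentations.PotentiallyTrivialAdmissible
import Literature.NumberTheory.GaloisRepresentations.PstWeilDeligne
import Mathlib.RingTheory.Discriminant
import HarnessLib

/-!
# Characters with coefficients: `B`-admissibility from a compatible family of periods

Generic `p`-adic Hodge theory of rank-one representations WITH COEFFICIENTS, for an arbitrary
period-ring datum `𝔅` (accepted `PeriodRingData`: a Fontaine-regular `(ℚ_p, Γ_F)`-ring `B` with
`B^{Γ_F} = F`) receiving the algebraic closure `Γ_F`-equivariantly (`ι : F̄ → B` over `F`, as in the
accepted `PeriodRingData.isAdmissible_of_isOpen`, file `PotentiallyTrivialAdmissible`).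

Let `E/ℚ_p` be finite and `V ≅ E` a continuous `ℚ_p`-linear representation of `Γ_F` on which
`σ` acts by multiplication by `ψ(σ) ∈ E` — the `ℚ_p`-linear representation underlying an
`E`-valued character, e.g. `restrictScalarsQl E rE` for a model `rE : Γ_F →ₜ* GL₁(E)` of
`r : Γ_F →ₜ* GL₁(ℚ̄_p)` (accepted `HasQlModel`).  Then `B ⊗_{ℚ_p} V ≅ ∏_{j : E → F̄} B` through the
`[E : ℚ_p]` embeddings `j` of `E` into `F̄` over `ℚ_p`, and `Γ_F` permutes the factors; hence
`V` is `B`-admissible as soon as there is a COMPATIBLE FAMILY OF PERIODS: nonzero `y_j ∈ B`,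
one for each `ℚ_p`-embedding `j : E → F̄`, with

  `y_{σ ∘ j} = ι((σ ∘ j)(ψ σ)) · σ(y_j)`   for all `σ ∈ Γ_F` and all `j`

(for `j` fixed by an open subgroup `H` this says `h(y_j) = ι(j(ψ h))⁻¹ y_j` on `H`: `y_j` is a
period of the `F̄`-valued character `j ∘ ψ` on `H`).  This is the coefficient version of the
accepted "one nonzero period suffices" (`PeriodRingData.isAdmissible_of_period`, file
`PeriodRingDataCharacter`, `ℚ_p`-valued characters) and is the form in which de Rham-ness of
Lubin–Tate and other locally algebraic characters is established (Fontaine 1994, Exp. III §1.5,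
Prop. 1.5.2 and §3; Serre 1968, Ch. III App. A; B. Conrad 2011, App. B: `D_dR` of an `E`-linear
representation is an `F ⊗_{ℚ_p} E`-module, computed embedding by embedding).  Everything here is
PROVED; no definitions of notions, no named facts:

* `PeriodRingData.isAdmissible_of_periodMatrix_of_det_ne_zero` — admissibility from a PERIOD MATRIX: if `b` is a
  `ℚ_p`-basis of `V` with `ρ(σ) b_i = Σ_k R(σ)_{ki} b_k` and `Y ∈ M_N(B)` has `det Y ≠ 0` and
  `Y = R(σ) · σ(Y)` for all `σ`, then `dim_F D_B(V) = dim V` (the columns of `Y` are `N` invariant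
  vectors, `B`-linearly independent; Fontaine's inequality, accepted `PeriodRingData.rank_D_le`).
  This is the common core of the accepted unramified / potentially-trivial cases; the accepted
  `PeriodRingData.isAdmissible_of_periodMatrix` (file `PstWeilDeligneDualDeRham`) is the variant
  with `det Y` a UNIT, phrased with `LinearMap.toMatrix`; here `det Y ≠ 0` suffices (`B` is a
  domain), which is what products of periods give.
* `absGalEmbComp σ j = σ ∘ j` — the action of `Γ_F` on the `ℚ_p`-embeddings `E → F̄`.
* `PeriodRingData.isAdmissible_of_characterPeriods` — the theorem above (period matrix
  `Y = A⁻¹ · diag(y) · A` with `A_{jk} = ι(j(e_k))` the embeddings matrix of a `ℚ_p`-basis `e` of `E`,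
  invertible because its determinant squares to the discriminant, Mathlib's
  `Algebra.discr_eq_det_embeddingsMatrixReindex_pow_two`, `Algebra.discr_not_zero_of_basis`).
* `FramedRep.isDeRhamWith_of_characterPeriods` — framed form: `r : Γ_F →ₜ* GL₁(ℚ̄_p)` with a model
  `rE` over a finite `E ⊆ ℚ̄_p` and a compatible family of periods for `ψ = rE(·)₀₀` is de Rham for
  `(alg, 𝔅)` (accepted `FramedRep.IsDeRhamWith`; for a `p`-adic Hodge datum `𝔇`, whose
  `IsDeRhamFramed` unfolds to `IsDeRhamWith 𝔇.algebra 𝔇.𝔅`, apply it under `letI := 𝔇.algebra`).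

What is NOT here: the construction of compatible families from periods given on ONE embedding per
`Γ_F`-orbit (induction along `Γ_F / Stab(j)`), and any specific period (cyclotomic, Lubin–Tate):
those are supplied by the period rings (files `PAdicHodge/BdR*`).

## References

* [FontaineAsterisque223III] J.-M. Fontaine, *Représentations p-adiques semi-stables*, Astérisque
  223 (1994), Exp. III §1.4–1.5 (regular rings, `D_B`, Prop. 1.5.2), §3 (de Rham representations).
* [SerreAbelianLadic1968] J.-P. Serre, *Abelian ℓ-adic representations and elliptic curves* (1968),
  Ch. III, App. A (Hodge–Tate decompositions of characters with coefficients).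
* [Conrad2011LiftingGlobal] B. Conrad, *Lifting global representations with local properties*
  (2011), App. B (de Rham / Hodge–Tate characters with coefficients, embedding by embedding).
* [BuzzardGeeLMS2014] K. Buzzard, T. Gee, *The conjectural connections …* (2014), §2.2 (models over
  finite `E/ℚ_p`).

## Mathlib reuse

`Algebra.embeddingsMatrixReindex`, `Algebra.discr_eq_det_embeddingsMatrixReindex_pow_two`,
`Algebra.discr_not_zero_of_basis`, `AlgHom.card`, `Algebra.leftMulMatrix_eq_repr_mul`,
`Matrix.nonsing_inv`, `Matrix.mul_nonsing_inv`, `Matrix.linearIndependent_cols_of_det_ne_zero`,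
`Algebra.TensorProduct.basis`, `Module.finBasis`; from the tree: `PeriodRingData` and `D`,
`tensorRep_apply_tmul`, `rank_D_le` (`UnramifiedAdmissible`), `FramedRep.IsDeRhamWith`, `HasQlModel`,
`restrictScalarsQl`, `IntermediateField.continuousSMul_padicAlgCl`.
-/

noncomputable section

open Field Matrix TensorProduct
open scoped MatrixGroups TensorProduct

namespace Literature.NumberTheory.GaloisRepresentations

universe u v v' w w'

/-! ### Admissibility from a period matrix -/

section PeriodMatrix

variable {Γ : Type u} [Group Γ] [TopologicalSpace Γ] {P : Type v} {K : Type v'} [Field P]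
  [TopologicalSpace P] [Field K] [Algebra P K]

-- Mathlib's own global value of `maxSynthPendingDepth` (see `PeriodRingData.rank_D_le`).
set_option maxSynthPendingDepth 3 in
/-- **Admissibility from a period matrix.**  Let `𝔅` be a period-ring datum for `(Γ, P, K)`,
`ρ` a continuous representation of `Γ` on a finite-dimensional `P`-space `V` with `P`-basis `b`,
`R : Γ → M_N(P)` its matrices (`ρ(σ) b_i = Σ_k R(σ)_{ki} b_k`), and `Y ∈ M_N(B)` a PERIOD MATRIX:
`det Y ≠ 0` and `Y_{kj} = Σ_i R(σ)_{ki} σ(Y_{ij})` (`Y = R(σ)·σ(Y)`).  Then `ρ` is `𝔅`-admissible,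
`dim_K D_B(V) = dim_P V`: the columns `w_j = Σ_i Y_{ij} ⊗ b_i` are invariant and `B`-linearly
independent (`B` is a domain), and Fontaine's inequality bounds the dimension from above.
[cite: FontaineAsterisque223III, Exp. III Prop. 1.4.2 and Thm. 1.5.2] -/
theorem PeriodRingData.isAdmissible_of_periodMatrix_of_det_ne_zero
    (𝔅 : PeriodRingData.{u, v, v', w} Γ P K)
    {V : Type w'} [AddCommGroup V] [Module P V] [TopologicalSpace V] [FiniteDimensional P V]
    (ρ : ContinuousRep Γ P V) {N : Type*} [Fintype N] [DecidableEq N] (b : Module.Basis N P V)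
    (R : Γ → Matrix N N P) (hbr : ∀ (σ : Γ) (i : N), ρ σ (b i) = ∑ k, R σ k i • b k)
    (Y : Matrix N N 𝔅.B) (hYdet : Y.det ≠ 0)
    (hY : ∀ (σ : Γ) (k j : N), Y k j = ∑ i, R σ k i • σ • Y i j) :
    𝔅.IsAdmissible ρ := by
  classical
  -- the invariant vectors
  let w : N → 𝔅.B ⊗[P] V := fun j => ∑ i, Y i j ⊗ₜ[P] b i
  have hwD : ∀ j, w j ∈ 𝔅.D ρ := by
    intro j
    rw [PeriodRingData.mem_D_iff]
    intro σ
    simp only [w, map_sum, PeriodRingData.tensorRep_apply_tmul]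
    calc ∑ i, (σ • Y i j) ⊗ₜ[P] ρ σ (b i)
        = ∑ i, ∑ k, (R σ k i • σ • Y i j) ⊗ₜ[P] b k := by
          refine Finset.sum_congr rfl fun i _ => ?_
          rw [hbr σ i, TensorProduct.tmul_sum]
          refine Finset.sum_congr rfl fun k _ => ?_
          exact (TensorProduct.smul_tmul _ _ _).symm
      _ = ∑ k, (∑ i, R σ k i • σ • Y i j) ⊗ₜ[P] b k := by
          rw [Finset.sum_comm]
          refine Finset.sum_congr rfl fun k _ => ?_
          rw [TensorProduct.sum_tmul]
      _ = ∑ k, Y k j ⊗ₜ[P] b k := Finset.sum_congr rfl fun k _ => by rw [← hY σ k j]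
  -- they are linearly independent over `B`, hence over `K`
  let β : Module.Basis N 𝔅.B (𝔅.B ⊗[P] V) := Algebra.TensorProduct.basis 𝔅.B b
  have hw : ∀ j, w j = β.equivFun.symm (Y.col j) := by
    intro j
    rw [Module.Basis.equivFun_symm_apply]
    refine Finset.sum_congr rfl fun i _ => ?_
    rw [Algebra.TensorProduct.basis_apply, TensorProduct.smul_tmul', smul_eq_mul, mul_one]
    rfl
  have hliB : LinearIndependent 𝔅.B w := by
    have h := (Matrix.linearIndependent_cols_of_det_ne_zero hYdet).map' β.equivFun.symm.toLinearMap
      (LinearEquiv.ker _)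
    rw [show w = ⇑β.equivFun.symm.toLinearMap ∘ Y.col from funext hw]
    exact h
  have hliK : LinearIndependent K w := by
    refine hliB.restrict_scalars ?_
    intro x y hxy
    have h : algebraMap K 𝔅.B x = algebraMap K 𝔅.B y := by
      simpa only [Algebra.smul_def, mul_one] using hxy
    exact (algebraMap K 𝔅.B).injective h
  -- count dimensions
  have hliD : LinearIndependent K (fun j => (⟨w j, hwD j⟩ : 𝔅.D ρ)) :=
    LinearIndependent.of_comp (𝔅.D ρ).subtype (by exact hliK)
  have hcard : Fintype.card N = Module.finrank P V := (Module.finrank_eq_card_basis b).symm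
  have h1 : (Module.finrank P V : Cardinal) ≤ Module.rank K (𝔅.D ρ) := by
    rw [← hcard]
    simpa using hliD.cardinal_lift_le_rank
  have h2 : Module.rank K (𝔅.D ρ) ≤ Module.finrank P V := 𝔅.rank_D_le ρ
  exact Module.finrank_eq_of_rank_eq (le_antisymm h2 h1)

end PeriodMatrix

/-! ### The action of `Γ_F` on the `ℚ_p`-embeddings `E → F̄` -/

section Embeddings

variable {F : Type u} [Field F] {p : ℕ} [Fact p.Prime] [Algebra ℚ_[p] F]
  {E : Type*} [Field E] [Algebra ℚ_[p] E]

/-- **`σ ∘ j`**: the `ℚ_p`-embedding `E → F̄` obtained from `j` by post-composition with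
`σ ∈ Γ_F = Aut_F(F̄)` (an `F`-, hence `ℚ_p`-algebra automorphism of `F̄`). [folklore] -/
def absGalEmbComp (σ : absoluteGaloisGroup F) (j : E →ₐ[ℚ_[p]] AlgebraicClosure F) :
    E →ₐ[ℚ_[p]] AlgebraicClosure F :=
  (((absoluteGaloisGroup.toAlgEquiv F σ : AlgebraicClosure F ≃ₐ[F] AlgebraicClosure F) :
    AlgebraicClosure F →ₐ[F] AlgebraicClosure F).restrictScalars ℚ_[p]).comp j

/-- `(σ ∘ j)(x) = σ • j(x)`. [folklore] -/
@[simp] theorem absGalEmbComp_apply (σ : absoluteGaloisGroup F) (j : E →ₐ[ℚ_[p]] AlgebraicClosure F)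
    (x : E) : absGalEmbComp σ j x = σ • j x := rfl

/-- `1 ∘ j = j`. [folklore] -/
@[simp] theorem absGalEmbComp_one (j : E →ₐ[ℚ_[p]] AlgebraicClosure F) :
    absGalEmbComp (1 : absoluteGaloisGroup F) j = j :=
  AlgHom.ext fun x => by rw [absGalEmbComp_apply, one_smul]

/-- `(σ τ) ∘ j = σ ∘ (τ ∘ j)`. [folklore] -/
theorem absGalEmbComp_mul (σ τ : absoluteGaloisGroup F) (j : E →ₐ[ℚ_[p]] AlgebraicClosure F) :
    absGalEmbComp (σ * τ) j = absGalEmbComp σ (absGalEmbComp τ j) :=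
  AlgHom.ext fun x => by simp only [absGalEmbComp_apply, mul_smul]

/-- `σ ∘ (σ⁻¹ ∘ j) = j`. [folklore] -/
@[simp] theorem absGalEmbComp_inv_cancel (σ : absoluteGaloisGroup F)
    (j : E →ₐ[ℚ_[p]] AlgebraicClosure F) : absGalEmbComp σ (absGalEmbComp σ⁻¹ j) = j := by
  rw [← absGalEmbComp_mul, mul_inv_cancel, absGalEmbComp_one]

/-- `σ⁻¹ ∘ (σ ∘ j) = j`. [folklore] -/
@[simp] theorem absGalEmbComp_inv_cancel_left (σ : absoluteGaloisGroup F)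
    (j : E →ₐ[ℚ_[p]] AlgebraicClosure F) : absGalEmbComp σ⁻¹ (absGalEmbComp σ j) = j := by
  rw [← absGalEmbComp_mul, inv_mul_cancel, absGalEmbComp_one]

end Embeddings

/-! ### Admissibility of a character with coefficients from a compatible family of periods -/

section Character

variable {F : Type u} [Field F] {p : ℕ} [Fact p.Prime] [Algebra ℚ_[p] F]

-- Mathlib's own global value of `maxSynthPendingDepth` (see `PeriodRingData.rank_D_le`).
set_option maxSynthPendingDepth 3 in
/-- **A character with coefficients in `E` is `B`-admissible as soon as it has a compatible family
of periods.**  Let `𝔅` be a period-ring datum for `Γ_F` over `ℚ_p` with invariants `F`,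
`ι : F̄ → B` a `Γ_F`-equivariant ring map extending `F → B`, `E/ℚ_p` a finite extension, and `ρ` a
continuous representation of `Γ_F` on a finite-dimensional Hausdorff `ℚ_p`-space `V` identified
with `E` by `θ : E ≃ V`, on which `σ` acts through multiplication by `ψ(σ) ∈ E`
(`ρ σ (θ c) = θ (ψ σ · c)`).  If `y_j ∈ B ∖ {0}` (`j` running over the `ℚ_p`-embeddings `E → F̄`)
satisfy `y_{σ∘j} = ι((σ∘j)(ψ σ)) · σ(y_j)` for all `σ`, `j`, then `dim_F (B ⊗_{ℚ_p} V)^{Γ_F} = dim_{ℚ_p} V`.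
Proof: with a `ℚ_p`-basis `e` of `E` and the embeddings matrix `A_{jk} = ι(j(e_k))` (invertible:
`det² =` discriminant `≠ 0`), the matrix `Y = A⁻¹ · diag(y) · A` is a period matrix for the basis
`θ(e)` (`isAdmissible_of_periodMatrix_of_det_ne_zero`); `D_B(V)` is computed embedding by embedding.
[cite: FontaineAsterisque223III, Exp. III §1.5 and Prop. 1.5.2]
[cite: Conrad2011LiftingGlobal, Appendix B] -/
theorem PeriodRingData.isAdmissible_of_characterPeriods
    (𝔅 : PeriodRingData.{u, 0, u, w} (absoluteGaloisGroup F) ℚ_[p] F)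
    (ι : AlgebraicClosure F →+* 𝔅.B)
    (hισ : ∀ (σ : absoluteGaloisGroup F) (x : AlgebraicClosure F), σ • ι x = ι (σ • x))
    (hιa : ∀ a : F, ι (algebraMap F (AlgebraicClosure F) a) = algebraMap F 𝔅.B a)
    {E : Type*} [Field E] [Algebra ℚ_[p] E] [FiniteDimensional ℚ_[p] E]
    {V : Type w'} [AddCommGroup V] [Module ℚ_[p] V] [TopologicalSpace V] [FiniteDimensional ℚ_[p] V]
    (ρ : ContinuousRep (absoluteGaloisGroup F) ℚ_[p] V) (ψ : absoluteGaloisGroup F → E)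
    (θ : E ≃ₗ[ℚ_[p]] V) (hρ : ∀ (σ : absoluteGaloisGroup F) (c : E), ρ σ (θ c) = θ (ψ σ * c))
    (y : (E →ₐ[ℚ_[p]] AlgebraicClosure F) → 𝔅.B) (hy0 : ∀ j, y j ≠ 0)
    (hy : ∀ (σ : absoluteGaloisGroup F) (j : E →ₐ[ℚ_[p]] AlgebraicClosure F),
      y (absGalEmbComp σ j) = ι (absGalEmbComp σ j (ψ σ)) * σ • y j) :
    𝔅.IsAdmissible ρ := by
  classical
  -- a `ℚ_p`-basis of `E`, the embeddings, and the matrices of `ρ`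
  set m := Module.finrank ℚ_[p] E with hm
  let e : Module.Basis (Fin m) ℚ_[p] E := Module.finBasis ℚ_[p] E
  haveI : Algebra.IsSeparable ℚ_[p] E := Algebra.IsSeparable.of_integral ℚ_[p] E
  have hcard : Fintype.card (Fin m) = Fintype.card (E →ₐ[ℚ_[p]] AlgebraicClosure F) := by
    rw [Fintype.card_fin, AlgHom.card]
  let ε : Fin m ≃ (E →ₐ[ℚ_[p]] AlgebraicClosure F) := Fintype.equivOfCardEq hcard
  let b : Module.Basis (Fin m) ℚ_[p] V := e.map θ
  let R : absoluteGaloisGroup F → Matrix (Fin m) (Fin m) ℚ_[p] := fun σ => Algebra.leftMulMatrix e (ψ σ)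
  have hR : ∀ σ k i, R σ k i = e.repr (ψ σ * e i) k := fun σ k i =>
    Algebra.leftMulMatrix_eq_repr_mul e (ψ σ) k i
  have hbr : ∀ (σ : absoluteGaloisGroup F) (i : Fin m), ρ σ (b i) = ∑ k, R σ k i • b k := by
    intro σ i
    simp only [b, Module.Basis.map_apply, hR]
    rw [hρ]
    conv_lhs => rw [← e.sum_repr (ψ σ * e i)]
    rw [map_sum]
    simp only [map_smul]
  -- `algebraMap ℚ_p B` factors through `ι`
  have hιq : ∀ c : ℚ_[p], algebraMap ℚ_[p] 𝔅.B c = ι (algebraMap ℚ_[p] (AlgebraicClosure F) c) := by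
    intro c
    rw [PeriodRingData.algebraMap_eq, ← hιa, IsScalarTower.algebraMap_apply ℚ_[p] F (AlgebraicClosure F)]
  -- the embeddings matrix `M_{ik} = ε_k(e_i)` over `F̄` and `A = ι(Mᵀ)`
  let M : Matrix (Fin m) (Fin m) (AlgebraicClosure F) :=
    Algebra.embeddingsMatrixReindex ℚ_[p] (AlgebraicClosure F) e ε
  have hM : ∀ i k, M i k = ε k (e i) := fun i k => rfl
  have hMdet : M.det ≠ 0 := by
    intro h0
    have h := Algebra.discr_eq_det_embeddingsMatrixReindex_pow_two ℚ_[p] (AlgebraicClosure F) e ε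
    rw [show Algebra.embeddingsMatrixReindex ℚ_[p] (AlgebraicClosure F) (⇑e) ε = M from rfl, h0,
      zero_pow two_ne_zero, map_eq_zero] at h
    exact Algebra.discr_not_zero_of_basis ℚ_[p] e h
  let A : Matrix (Fin m) (Fin m) 𝔅.B := ι.mapMatrix Mᵀ
  have hA : ∀ j k, A j k = ι (ε j (e k)) := fun j k => rfl
  have hAdet : IsUnit A.det := by
    have h : A.det = ι (Mᵀ.det) := (RingHom.map_det ι Mᵀ).symm
    rw [h, Matrix.det_transpose]
    exact (IsUnit.mk0 _ hMdet).map ι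
  -- the period matrix `Y = A⁻¹ · diag(y) · A`
  let yv : Fin m → 𝔅.B := fun j => y (ε j)
  let Z : Matrix (Fin m) (Fin m) 𝔅.B := Matrix.diagonal yv * A
  have hZ : ∀ j i, Z j i = yv j * A j i := fun j i => by
    simp only [Z, Matrix.diagonal_mul]
  let Y : Matrix (Fin m) (Fin m) 𝔅.B := A⁻¹ * Z
  have hAY : A * Y = Z := by
    simp only [Y]
    rw [← Matrix.mul_assoc, Matrix.mul_nonsing_inv _ hAdet, Matrix.one_mul]
  have hYdet : Y.det ≠ 0 := by
    have h1 : Y.det * A.det = Z.det := by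
      rw [mul_comm, ← Matrix.det_mul, hAY]
    have h2 : Z.det = (∏ j, yv j) * A.det := by
      simp only [Z, Matrix.det_mul, Matrix.det_diagonal]
    have h3 : (∏ j, yv j) ≠ 0 := Finset.prod_ne_zero_iff.mpr fun j _ => hy0 (ε j)
    intro h0
    rw [h0, zero_mul, h2] at h1
    exact (mul_ne_zero h3 hAdet.ne_zero) h1.symm
  -- `A` transforms under `σ⁻¹` by the permutation `j ↦ σ⁻¹ ∘ j` of its rows
  have hAσ : ∀ (σ : absoluteGaloisGroup F) (j k : Fin m),
      σ⁻¹ • A j k = A (ε.symm (absGalEmbComp σ⁻¹ (ε j))) k := by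
    intro σ j k
    rw [hA, hA, hισ, Equiv.apply_symm_apply, absGalEmbComp_apply]
  -- Step 1: `Σ_k A_{jk} R(σ)_{kl} = ι(ε_j(ψ σ)) A_{jl}`
  have hstep1 : ∀ (σ : absoluteGaloisGroup F) (j l : Fin m),
      ∑ k, A j k * algebraMap ℚ_[p] 𝔅.B (R σ k l) = ι (ε j (ψ σ)) * A j l := by
    intro σ j l
    simp only [hA, hιq, ← map_mul, ← map_sum]
    congr 1
    have h1 : ∑ k, ε j (e k) * algebraMap ℚ_[p] (AlgebraicClosure F) (R σ k l) =
        ε j (∑ k, R σ k l • e k) := by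
      rw [map_sum]
      refine Finset.sum_congr rfl fun k _ => ?_
      rw [map_smul, Algebra.smul_def, mul_comm]
    rw [h1]
    have h2 : ∑ k, R σ k l • e k = ψ σ * e l := by
      simp only [hR]
      exact e.sum_repr (ψ σ * e l)
    rw [h2, map_mul]
  -- Step 2: the period-matrix identity `Y = R(σ) σ(Y)`, after multiplying by `A`
  have hY : ∀ (σ : absoluteGaloisGroup F) (k i : Fin m), Y k i = ∑ l, R σ k l • σ • Y l i := by
    intro σ
    -- it suffices to prove it after multiplying by the invertible `A`
    let W : Matrix (Fin m) (Fin m) 𝔅.B := fun k i => ∑ l, R σ k l • σ • Y l i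
    suffices hW : A * Y = A * W by
      have h := congrArg (fun X => A⁻¹ * X) hW
      simp only [← Matrix.mul_assoc, Matrix.nonsing_inv_mul _ hAdet, Matrix.one_mul] at h
      intro k i
      exact congrFun (congrFun h k) i
    ext j i
    rw [hAY, hZ, Matrix.mul_apply]
    -- right-hand side, entry `(j, i)`
    have hrhs : ∑ k, A j k * W k i = ι (ε j (ψ σ)) * σ • (∑ l, (σ⁻¹ • A j l) * Y l i) := by
      simp only [W, Finset.mul_sum, Algebra.smul_def, smul_mul', Finset.smul_sum, smul_smul,
        mul_inv_cancel, one_smul]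
      rw [Finset.sum_comm]
      simp only [← mul_assoc, ← Finset.sum_mul]
      refine Finset.sum_congr rfl fun l _ => ?_
      rw [hstep1 σ j l, mul_assoc]
    rw [hrhs]
    -- `Σ_l σ⁻¹(A_{jl}) Y_{li} = (A Y)_{j', i} = Z_{j', i}` with `j' ↔ σ⁻¹ ∘ ε_j`
    let j' : Fin m := ε.symm (absGalEmbComp σ⁻¹ (ε j))
    have hεj' : ε j' = absGalEmbComp σ⁻¹ (ε j) := Equiv.apply_symm_apply ε _
    have hsum : ∑ l, (σ⁻¹ • A j l) * Y l i = Z j' i := by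
      rw [← hAY, Matrix.mul_apply]
      refine Finset.sum_congr rfl fun l _ => ?_
      rw [hAσ]
    have hσA : σ • A j' i = A j i := by
      rw [hA, hA, hεj', absGalEmbComp_apply, hισ, smul_inv_smul]
    rw [hsum, hZ, smul_mul', hσA, ← mul_assoc]
    congr 1
    -- the compatibility of the periods, at `j := σ⁻¹ ∘ ε_j`
    have h := hy σ (absGalEmbComp σ⁻¹ (ε j))
    rw [absGalEmbComp_inv_cancel] at h
    show y (ε j) = ι ((ε j) (ψ σ)) * σ • y (ε j')
    rw [hεj']
    exact h
  exact 𝔅.isAdmissible_of_periodMatrix_of_det_ne_zero ρ b R hbr Y hYdet hY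

end Character

/-! ### Framed form: `r : Γ_F →ₜ* GL₁(ℚ̄_p)` with a model over `E ⊆ ℚ̄_p` -/

section Framed

variable {F : Type} [Field F] {p : ℕ} [Fact p.Prime]

/-- The value `ψ(σ) = rE(σ)₀₀ ∈ E` of a rank-one framed representation over `E`. [folklore] -/
theorem restrictScalarsQl_apply_funUnique_symm {E : IntermediateField ℚ_[p] (PadicAlgCl p)}
    (rE : FramedRep (absoluteGaloisGroup F) E 1) (σ : absoluteGaloisGroup F) (c : E) :
    Literature.NumberTheory.Automorphic.restrictScalarsQl E rE σ
        ((LinearEquiv.funUnique (Fin 1) ℚ_[p] E).symm c) =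
      (LinearEquiv.funUnique (Fin 1) ℚ_[p] E).symm
        ((((rE σ : GL (Fin 1) E) : Matrix (Fin 1) (Fin 1) E) 0 0) * c) := by
  funext i
  rw [Literature.NumberTheory.Automorphic.restrictScalarsQl_apply_apply,
    FramedRep.toContinuousRep_apply_apply]
  simp only [LinearEquiv.funUnique, Matrix.mulVec, dotProduct, Fin.sum_univ_one,
    Subsingleton.elim i 0]
  rfl

-- Mathlib's own global value of `maxSynthPendingDepth` (see `PeriodRingData.rank_D_le`).
set_option maxSynthPendingDepth 3 in
/-- **A rank-one `r : Γ_F →ₜ* GL₁(ℚ̄_p)` with a compatible family of periods is de Rham for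
`(alg, 𝔅)`.**  Let `alg` be a `ℚ_p`-structure on the field `F`, `𝔅` a period-ring
datum for `Γ_F` over `ℚ_p` with invariants `F` receiving `F̄` equivariantly through `ι`, `rE` a model of
`r` over a finite `E ⊆ ℚ̄_p` (accepted `HasQlModel`), `ψ(σ) = rE(σ)₀₀ ∈ E`, and `y_j ∈ B ∖ {0}`
(`j : E → F̄` over `ℚ_p`) with `y_{σ∘j} = ι((σ∘j)(ψ σ)) σ(y_j)`.  Then `r` is de Rham for `(alg, 𝔅)`
(accepted `FramedRep.IsDeRhamWith`: the `ℚ_p`-linear representation `restrictScalarsQl E rE` on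
`E = Fin 1 → E` is `𝔅`-admissible, `isAdmissible_of_characterPeriods`).
[cite: FontaineAsterisque223III, Exp. III §1.5 and Prop. 1.5.2]
[cite: Conrad2011LiftingGlobal, Appendix B] -/
theorem FramedRep.isDeRhamWith_of_characterPeriods (alg : Algebra ℚ_[p] F)
    (𝔅 : PeriodRingData.{0, 0, 0, 0} (absoluteGaloisGroup F) ℚ_[p] F)
    (ι : AlgebraicClosure F →+* 𝔅.B)
    (hισ : ∀ (σ : absoluteGaloisGroup F) (x : AlgebraicClosure F), σ • ι x = ι (σ • x))
    (hιa : ∀ a : F, ι (algebraMap F (AlgebraicClosure F) a) = algebraMap F 𝔅.B a)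
    (r : FramedRep (absoluteGaloisGroup F) (PadicAlgCl p) 1)
    {E : IntermediateField ℚ_[p] (PadicAlgCl p)} [FiniteDimensional ℚ_[p] E]
    {rE : FramedRep (absoluteGaloisGroup F) E 1}
    (hmodel : Literature.NumberTheory.Automorphic.HasQlModel r E rE)
    (y : (E →ₐ[ℚ_[p]] AlgebraicClosure F) → 𝔅.B) (hy0 : ∀ j, y j ≠ 0)
    (hy : ∀ (σ : absoluteGaloisGroup F) (j : E →ₐ[ℚ_[p]] AlgebraicClosure F),
      y (absGalEmbComp σ j) =
        ι (absGalEmbComp σ j ((((rE σ : GL (Fin 1) E) : Matrix (Fin 1) (Fin 1) E) 0 0))) * σ • y j) :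
    r.IsDeRhamWith alg 𝔅 := by
  haveI : ContinuousSMul ℚ_[p] E := IntermediateField.continuousSMul_padicAlgCl E
  refine ⟨E, ‹_›, rE, hmodel, ?_⟩
  exact 𝔅.isAdmissible_of_characterPeriods ι hισ hιa
    (Literature.NumberTheory.Automorphic.restrictScalarsQl E rE)
    (fun σ => (((rE σ : GL (Fin 1) E) : Matrix (Fin 1) (Fin 1) E) 0 0))
    (LinearEquiv.funUnique (Fin 1) ℚ_[p] E).symm
    (fun σ c => restrictScalarsQl_apply_funUnique_symm rE σ c) y hy0 hy

end Framed

end Literature.NumberTheory.GaloisRepresentations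

end
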